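import Summits.QuantumFields.YangMills.Theorems.BalabanUVNodesN18UniformDecayOfStepRate
import Summits.QuantumFields.YangMills.Theorems.BalabanUVNodesK3V5StubsLetterForm

/-!
# BalabanUVNodes ∕ N18 — K3⁷'s (D4) WINDOWED-DECAY ROW IS A CONSEQUENCE OF node N18's STEP-RATE ROW + THE LEVEL-0 ROW: stub 1's text and the item
# by name read THREE kernel letters + level 0 (Track A, DAG node N18 = NE5 `T4OutputRate.NE5`; cluster K4 «SpineRates»; key K3⁷ `SpineGivenEndpointR13SepCoPH`
# = stmt-QuantumFields-20544, skeleton v5 941dddb108cbaacf; width seat `pub-ymgap-dag-n18-w4` g4, FILE 6 of the seat's kernel-currency lineage, sequel of FILE 5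
# `…N18UniformDecayOfStepRate` p615806; `--kind proof --supports stmt-QuantumFields-20544 --as helper`, COUNT-NEUTRAL)

HONEST FRAMING.  Junction ∕ bookkeeping lemmas in HYPOTHESIS FORM.  dag-n27-w1's bill `K3V5Defs.keyedRatesHolderD4_rrOfRecord_of_pins_of_letters` (p606160) and its
stub-1 ∕ item corollaries `stub1Text_of_rows`, `spineGivenEndpointR13SepCoPH_of_rows_of_stub2Text` (p608315) read FOUR finite-volume kernel letters of record —
`hL : PolLimitsExistOfRecord₁₃` ((1.21) exists), `h9 : WindowedNE9OfRecord₁₃` (node N22), `hW : WindowedDecayOfRecord₁₃ … 0 1 κ` ((D4)'s windowed (5.10) decay) and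
`hS : WindowedStepRateOfRecord₁₃ …` (node N18) — next to THE END's N16 sentence `h16` and the U3 letter rows.  FILE 5 showed that the k-uniform decay rows telescope
DOWN to level 0 along node N18's step rate.  THIS FILE draws the consequence for the crux's displayed inputs: `hW` is NOT an independent input — it follows from `hS`,
the letter signs and ONE level-0 row (the windowed (5.10) decay of the FIRST RG step's kernel of the merged term of record, eventually in the volume index, one
constant `E₀ F θ` per guarded tuple).  So stub 1's text VERBATIM and the item BY NAME are obtained from THREE kernel letters `hL h9 hS` + the level-0 row (§2–§4), and, in
the LIMITING-kernel currency, from `hL h9` + node N18's limit letter `KernelStepRateOfRecord₁₃` + the level-0 (5.10) class of the LIMITING kernels — NO windowed step-rate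
letter, NO windowed (5.10) letter (§2–§4, `…limitLetters…`).  §5 is node N17's scale-shift sentence at the LIMIT level with NO (1.21)-existence letter and NO (UD) letter
(g3's open question (E)); §6 is a MODEL-LEVEL (A6) joint inhabitant of the level-0 row and the step-rate letter (dag-n18-w2's fading on-site family p609711) through
FILE 5's telescope — non-vacuity of the conjunction, nothing of the record.  EVERY row (THE END's N16 sentence, `hL h9 hS` ∕ `h18`, the level-0 row, stub 2's text) is
a DISPLAYED HYPOTHESIS inhabited for no family today (K0⁷ OPEN); the level-0 row is an estimate of [I] §1 ∕ (5.10) type — NOT PRINTED separately, NOT proved here;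
nothing of Bałaban is asserted; NOT a proof of `stub_rates13H` ∕ `stub_expansion13H`; N16 ∕ N17 ∕ N18 ∕ N22 ∕ (D4) NOT discharged; K3⁷ OPEN, not claimed; skeleton v5
UNTOUCHED; counts unmoved (typed 28∕28 · discharged 5∕28).  One finite four-torus programme at fixed ε — R4 closes the CONDITIONAL rung `BalabanLadder.UV` only;
nothing continuum ∕ ℝ⁴ ∕ OS ∕ mass gap ∕ Clay; no summit statement is proved by this seat.  THEOREMS ONLY: 0 `def`, 0 `sorry`, standard axioms.

CONTENTS.
§1 GUARDED ROWS (generic `N`, regime `Rg`, dag-n27's `…N27AtKernelPinnedReading13CoPHLetters` binder shapes): `windowedDecayUniformOfRecord₁₃_guarded_of_stepRate_of_base` ·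
★ `windowedDecayOfRecord₁₃_guarded_of_stepRate_of_base` (the bill's `hW`, every direction pair) · `kernelDecayOfRecord₁₃_guarded_of_stepRate_of_base` (+ `hL`; dag-n27's
`kernelDecayOfRecord₁₃_of_letters_guarded` with NO `hW`) · `kernelDecayOfRecord₁₃_guarded_of_kernelStepRate_of_base` (LIMIT currency) · `n18At_guarded_of_kernelStepRateOfRecord₁₃`.
§2 THE BILL MINUS `hW` (`N = 2`, K3V5Defs names): ★★ `keyedRatesHolderD4_rrOfRecord_of_pins_of_threeLetters_of_base` · ★ `keyedRatesHolderD4_rrOfRecord_of_pins_of_limitLetters_of_base`.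
§3 STUB 1's TEXT VERBATIM: ★★ `stub1Text_of_threeLetters_of_base` · `stub1Text_of_limitLetters_of_base`.
§4 THE ITEM BY NAME under displayed texts: ★★ `spineGivenEndpointR13SepCoPH_of_threeLetters_of_base_of_stub2Text` · `spineGivenEndpointR13SepCoPH_of_limitLetters_of_base_of_stub2Text`
(stub 2's LETTER FORM is one `K3V5Defs.stub2Text_iff_letterForm.2` away).
§5 (E) N17 AT THE LIMIT LEVEL, NO (1.21)∕(UD) LETTER: ★ `scaleShiftRate_betaMerged_of_kernelStepRate_of_base` · `scaleShiftRate_betaMergedOfRecord_of_kernelStepRateOfRecord₁₃_of_base`.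
§6 A6 (model level): `baseRow_fading` · `windowedDecayUniform_fading_of_stepRate_of_base`.

Sources (TYPES and the mechanism only): T. Bałaban, Commun. Math. Phys. **109** (1987) 249–301 [Balaban1987RG1] — Thm 1 p. 259, (1.6) p. 261, (1.18) p. 263,
(1.20)–(1.22) p. 264, (5.10) p. 293.  No claim about the mass gap.
-/

set_option autoImplicit false

noncomputable section

open Filter Topology
open scoped BigOperators Matrix.Norms.L2Operator

namespace YMDAG.N18.ThreeKernelLettersAndBase

open Literature.MathematicalPhysics.QuantumFieldTheory.Balaban1983to89
open Literature.MathematicalPhysics.QuantumFieldTheory.Balaban1983to89.T4Continuum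
open Literature.MathematicalPhysics.QuantumFieldTheory.Balaban1983to89.T4OutputRate (Window DecayBound mem_window)
open Literature.MathematicalPhysics.QuantumFieldTheory.Balaban1983to89.T4CouplingMatching (ScaleShiftRate)
open Literature.MathematicalPhysics.QuantumFieldTheory.Balaban1983to89.B12Sec2to5 (l1 Decay510 betaPrime510)
open T4ContinuumYM4Torus (ForSmallCouplings)
open Summit.QuantumFields.BalabanUV.T4Continuum
open Summit.QuantumFields.BalabanUV.T4Continuum.Spine
open MinimalActionRate (sfClass)
open YMDAG.UVSplit
open Node00 (TermFamily1 polWindow Stage13Params Stage13HParams datumOfRecord₁₃CoPH U3Letters₁₁ NE3Letters₁₁ ne3ConstLayerOfRecord₁₁ ne3NperOfRecord₁₁ ne3DomOfRecord₁₁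
  betaMerged mergedTermFamilyMatT TβOfRecord₁₃ chiβOfRecord₁₃)
open Node00.U3OfKernels (histPrefix histPrefix_apply kernelA objectsOfRecord₁₃ KernelDecayOfRecord₁₃)
open Node00.U3KernelLetters (KernelStepRate PolLimitsExistOfRecord₁₃ WindowedNE9OfRecord₁₃ WindowedDecayOfRecord₁₃ WindowedStepRateOfRecord₁₃ KernelStepRateOfRecord₁₃)
open Node00.U3KernelLetters2 (WindowedDecayUniform WindowedDecayUniformOfRecord₁₃)
open Summit.QuantumFields.YangMills.BalabanUVNodes.N16HolderDefs (N16HolderAt)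
open Summit.QuantumFields.YangMills.BalabanUVNodes.N16PinnedLayer13CoPH (N16LettersEnd rateCarriers_ne3_of_pinnedLoose
  n16HolderAtReading_iff_of_pinnedLoose)
open Summit.QuantumFields.YangMills.BalabanUVNodes.N15.AtKeyedHome (neZero_blockFactor)
open Summit.QuantumFields.YangMills.Theorems.K3V5Defs
open Summit.QuantumFields.YangMills.Theorems.BalabanUVNodesN27SpineRecord (pHolderD4Body_rateCarriers_of_kernels_pin n22At_kernels_of_letters_guarded)
open YMDAG.N18.UniformDecayOfStepRate (windowedDecayUniformOfRecord₁₃_of_windowedStepRateOfRecord₁₃_of_base kernelDecayOfRecord₁₃_of_letters_of_base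
  kernelDecayOfRecord₁₃_of_kernelStepRateOfRecord₁₃_of_base decayBound_EA_of_kernelStepRate_of_base windowedDecayUniform_of_windowedStepRate_of_base)
open YMDAG.N18.AtRecordOfKernelLetters (n18At_u3OfRecord₁₃_objects_iff_kernelStepRate_letter n18At_u3OfRecord₁₃_objectsOfRecord₁₃_of_kernelStepRateOfRecord₁₃)
open YMDAG.N18.KernelStepRateBoxes (scaleShiftRate_betaMerged_of_n18At_objects_of_decayBound)
open YMDAG.N18.FiniteVolumeLettersModel (fadingTermFamily fadingAmp_zero polWindow_fadingTermFamily_eventually windowedStepRate_fading)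

/-! ## §1 Guarded rows: the (D4) rows of the bill from node N18's step-rate row + the level-0 row (any `N`, any regime `Rg`) -/

section Guarded

variable {N : ℕ} [NeZero N] (Rg : (F : T4Family) → Stage13HParams F N → Prop)
  (ℓ : (F : T4Family) → Stage13HParams F N → U3Letters₁₁) (s : (F : T4Family) → Stage13HParams F N → ℕ)
  (E₀ : (F : T4Family) → Stage13HParams F N → ℝ)

/-- **W1-19c's UNIFORM LETTER OF RECORD, GUARDED, FROM THE STEP-RATE ROW + THE LEVEL-0 ROW** (FILE 5 §5 per guarded tuple; constant
`E₀ F θ + (ℓ F θ).C₅·(ℓ F θ).θ₅ ∕ (1 − (ℓ F θ).θ₅)`, signs from `(ℓ F θ).Signs`). [cite: Balaban1987RG1, Thm 1 p.259, (1.20) p.264 and (5.10) p.293 (mechanism; nothing of the record asserted)] -/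
theorem windowedDecayUniformOfRecord₁₃_guarded_of_stepRate_of_base
    (hs : ∀ (F : T4Family) (θ : Stage13HParams F N), θ.Provisos₁₃CoPH F N → Rg F θ → θ.Admissible F N → (ℓ F θ).Signs)
    (hS : ∀ (F : T4Family) (θ : Stage13HParams F N), θ.Provisos₁₃CoPH F N → Rg F θ → θ.Admissible F N →
      WindowedStepRateOfRecord₁₃ F N θ.toStage13Params (s F θ) (ℓ F θ).κ (ℓ F θ).θ₅ ((ℓ F θ).C₅ * (ℓ F θ).θ₅))
    (h0 : ∀ (F : T4Family) (θ : Stage13HParams F N), θ.Provisos₁₃CoPH F N → Rg F θ → θ.Admissible F N →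
      letI := θ.toStage13Params.instVβ₁; letI := θ.toStage13Params.instVβ₂; letI := θ.toStage13Params.instιβ
      ∀ g ∈ Window θ.toStage13Params.γ, ∀ (μ ν : Fin 4) (z : Fin 4 → ℤ), ∀ᶠ K in atTop,
        |polWindow F K 1 (mergedTermFamilyMatT F N (TβOfRecord₁₃ F N) (chiβOfRecord₁₃ F N θ.toStage13Params) θ.toStage13Params.εbg 0 (histPrefix g 0) K)
            θ.toStage13Params.ρ8 θ.toStage13Params.bV μ ν z| ≤ E₀ F θ * Real.exp (-(ℓ F θ).κ * l1 z)) :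
    ∀ (F : T4Family) (θ : Stage13HParams F N), θ.Provisos₁₃CoPH F N → Rg F θ → θ.Admissible F N →
      WindowedDecayUniformOfRecord₁₃ F N θ.toStage13Params (E₀ F θ + (ℓ F θ).C₅ * (ℓ F θ).θ₅ / (1 - (ℓ F θ).θ₅)) (ℓ F θ).κ :=
  fun F θ hP hRg hθ =>
    windowedDecayUniformOfRecord₁₃_of_windowedStepRateOfRecord₁₃_of_base F N θ.toStage13Params (hs F θ hP hRg hθ).θ₅_pos.le (hs F θ hP hRg hθ).θ₅_lt_one
      (mul_nonneg (hs F θ hP hRg hθ).C₅_nonneg (hs F θ hP hRg hθ).θ₅_pos.le) (hS F θ hP hRg hθ) (h0 F θ hP hRg hθ)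

/-- ★ **THE BILL's ROW `hW` IS DERIVED**: per guarded tuple, node N18's step-rate row `hS`, the letter signs and the level-0 row give W1-19b's per-sequence letter of record
`WindowedDecayOfRecord₁₃ F N θ μ ν (ℓ F θ).κ` in EVERY direction pair — at `(μ, ν) = (0, 1)` exactly the row `hW` of dag-n27-w1's `K3V5Defs.keyedRatesHolderD4_rrOfRecord_of_pins_of_letters`.
[cite: Balaban1987RG1, Thm 1 p.259 and (5.10) p.293 (mechanism; nothing of the record asserted)] -/
theorem windowedDecayOfRecord₁₃_guarded_of_stepRate_of_base
    (hs : ∀ (F : T4Family) (θ : Stage13HParams F N), θ.Provisos₁₃CoPH F N → Rg F θ → θ.Admissible F N → (ℓ F θ).Signs)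
    (hS : ∀ (F : T4Family) (θ : Stage13HParams F N), θ.Provisos₁₃CoPH F N → Rg F θ → θ.Admissible F N →
      WindowedStepRateOfRecord₁₃ F N θ.toStage13Params (s F θ) (ℓ F θ).κ (ℓ F θ).θ₅ ((ℓ F θ).C₅ * (ℓ F θ).θ₅))
    (h0 : ∀ (F : T4Family) (θ : Stage13HParams F N), θ.Provisos₁₃CoPH F N → Rg F θ → θ.Admissible F N →
      letI := θ.toStage13Params.instVβ₁; letI := θ.toStage13Params.instVβ₂; letI := θ.toStage13Params.instιβ
      ∀ g ∈ Window θ.toStage13Params.γ, ∀ (μ ν : Fin 4) (z : Fin 4 → ℤ), ∀ᶠ K in atTop,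
        |polWindow F K 1 (mergedTermFamilyMatT F N (TβOfRecord₁₃ F N) (chiβOfRecord₁₃ F N θ.toStage13Params) θ.toStage13Params.εbg 0 (histPrefix g 0) K)
            θ.toStage13Params.ρ8 θ.toStage13Params.bV μ ν z| ≤ E₀ F θ * Real.exp (-(ℓ F θ).κ * l1 z)) :
    ∀ (F : T4Family) (θ : Stage13HParams F N), θ.Provisos₁₃CoPH F N → Rg F θ → θ.Admissible F N → ∀ μ ν : Fin 4,
      WindowedDecayOfRecord₁₃ F N θ.toStage13Params μ ν (ℓ F θ).κ :=
  fun F θ hP hRg hθ μ ν => (windowedDecayUniformOfRecord₁₃_guarded_of_stepRate_of_base Rg ℓ s E₀ hs hS h0 F θ hP hRg hθ).windowedDecayOfRecord₁₃ F μ ν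

/-- **THE (5.10) CLAUSE OF RECORD, GUARDED, WITH NO `hW`**: `hL` + `hS` + signs + the level-0 row give `KernelDecayOfRecord₁₃ F N θ μ ν (ℓ F θ).κ` in every direction pair
(dag-n27's `kernelDecayOfRecord₁₃_of_letters_guarded` reads `hL` + `hW`; here `hW` is FILE 5's consequence). [cite: Balaban1987RG1, (1.21) p.264 and (5.10) p.293 (mechanism; nothing of the record asserted)] -/
theorem kernelDecayOfRecord₁₃_guarded_of_stepRate_of_base
    (hs : ∀ (F : T4Family) (θ : Stage13HParams F N), θ.Provisos₁₃CoPH F N → Rg F θ → θ.Admissible F N → (ℓ F θ).Signs)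
    (hL : ∀ (F : T4Family) (θ : Stage13HParams F N), θ.Provisos₁₃CoPH F N → Rg F θ → θ.Admissible F N → PolLimitsExistOfRecord₁₃ F N θ.toStage13Params)
    (hS : ∀ (F : T4Family) (θ : Stage13HParams F N), θ.Provisos₁₃CoPH F N → Rg F θ → θ.Admissible F N →
      WindowedStepRateOfRecord₁₃ F N θ.toStage13Params (s F θ) (ℓ F θ).κ (ℓ F θ).θ₅ ((ℓ F θ).C₅ * (ℓ F θ).θ₅))
    (h0 : ∀ (F : T4Family) (θ : Stage13HParams F N), θ.Provisos₁₃CoPH F N → Rg F θ → θ.Admissible F N →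
      letI := θ.toStage13Params.instVβ₁; letI := θ.toStage13Params.instVβ₂; letI := θ.toStage13Params.instιβ
      ∀ g ∈ Window θ.toStage13Params.γ, ∀ (μ ν : Fin 4) (z : Fin 4 → ℤ), ∀ᶠ K in atTop,
        |polWindow F K 1 (mergedTermFamilyMatT F N (TβOfRecord₁₃ F N) (chiβOfRecord₁₃ F N θ.toStage13Params) θ.toStage13Params.εbg 0 (histPrefix g 0) K)
            θ.toStage13Params.ρ8 θ.toStage13Params.bV μ ν z| ≤ E₀ F θ * Real.exp (-(ℓ F θ).κ * l1 z)) :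
    ∀ (F : T4Family) (θ : Stage13HParams F N), θ.Provisos₁₃CoPH F N → Rg F θ → θ.Admissible F N → ∀ μ ν : Fin 4,
      KernelDecayOfRecord₁₃ F N θ.toStage13Params μ ν (ℓ F θ).κ :=
  fun F θ hP hRg hθ μ ν => kernelDecayOfRecord₁₃_of_letters_of_base F N θ.toStage13Params (ℓ F θ) (hs F θ hP hRg hθ) (hL F θ hP hRg hθ) (hS F θ hP hRg hθ)
    (h0 F θ hP hRg hθ) μ ν

/-- **LIMIT CURRENCY: THE (5.10) CLAUSE OF RECORD, GUARDED, FROM node N18's LIMIT LETTER + THE LEVEL-0 (5.10) CLASS OF THE LIMITING KERNELS** —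
`KernelStepRateOfRecord₁₃ F N θ (ℓ F θ).κ (ℓ F θ).θ₅ (ℓ F θ).C₅` + signs + `Decay510 (Π_1(g_0; ·)) (E₀ F θ) (ℓ F θ).κ` on the window ⟹ `KernelDecayOfRecord₁₃ F N θ μ ν (ℓ F θ).κ`;
NO (1.21)-existence letter, NO windowed letter. [cite: Balaban1987RG1, Thm 1 p.259 and (5.10) p.293 (mechanism; nothing of the record asserted)] -/
theorem kernelDecayOfRecord₁₃_guarded_of_kernelStepRate_of_base
    (hs : ∀ (F : T4Family) (θ : Stage13HParams F N), θ.Provisos₁₃CoPH F N → Rg F θ → θ.Admissible F N → (ℓ F θ).Signs)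
    (h18 : ∀ (F : T4Family) (θ : Stage13HParams F N), θ.Provisos₁₃CoPH F N → Rg F θ → θ.Admissible F N →
      KernelStepRateOfRecord₁₃ F N θ.toStage13Params (ℓ F θ).κ (ℓ F θ).θ₅ (ℓ F θ).C₅)
    (h0 : ∀ (F : T4Family) (θ : Stage13HParams F N), θ.Provisos₁₃CoPH F N → Rg F θ → θ.Admissible F N →
      letI := θ.toStage13Params.instVβ₁; letI := θ.toStage13Params.instVβ₂; letI := θ.toStage13Params.instιβ
      ∀ g ∈ Window θ.toStage13Params.γ, ∀ (μ ν : Fin 4),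
        Decay510 (kernelA F (mergedTermFamilyMatT F N (TβOfRecord₁₃ F N) (chiβOfRecord₁₃ F N θ.toStage13Params) θ.toStage13Params.εbg)
          θ.toStage13Params.ρ8 θ.toStage13Params.bV g 0 μ ν) (E₀ F θ) (ℓ F θ).κ) :
    ∀ (F : T4Family) (θ : Stage13HParams F N), θ.Provisos₁₃CoPH F N → Rg F θ → θ.Admissible F N → ∀ μ ν : Fin 4,
      KernelDecayOfRecord₁₃ F N θ.toStage13Params μ ν (ℓ F θ).κ :=
  fun F θ hP hRg hθ μ ν => kernelDecayOfRecord₁₃_of_kernelStepRateOfRecord₁₃_of_base F N θ.toStage13Params (hs F θ hP hRg hθ).θ₅_pos.le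
    (hs F θ hP hRg hθ).θ₅_lt_one (hs F θ hP hRg hθ).C₅_nonneg (h18 F θ hP hRg hθ) (h0 F θ hP hRg hθ) μ ν

/-- **LIMIT CURRENCY: node N18 AT THE KERNEL BUNDLE OF RECORD, GUARDED, FROM ITS LIMIT LETTER** (dag-n18-w1's per-tuple face, every run length).
[cite: Balaban1987RG1, Thm 1 p.259 and (1.21) p.264 (bookkeeping)] -/
theorem n18At_guarded_of_kernelStepRateOfRecord₁₃
    (h18 : ∀ (F : T4Family) (θ : Stage13HParams F N), θ.Provisos₁₃CoPH F N → Rg F θ → θ.Admissible F N →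
      KernelStepRateOfRecord₁₃ F N θ.toStage13Params (ℓ F θ).κ (ℓ F θ).θ₅ (ℓ F θ).C₅) :
    ∀ (F : T4Family) (θ : Stage13HParams F N), θ.Provisos₁₃CoPH F N → Rg F θ → θ.Admissible F N → ∀ k : ℕ,
      N18At (u3OfRecord₁₃ θ.toStage13Params (objectsOfRecord₁₃ F N θ.toStage13Params (ℓ F θ)) k) :=
  fun F θ hP hRg hθ k => n18At_u3OfRecord₁₃_objectsOfRecord₁₃_of_kernelStepRateOfRecord₁₃ F N θ.toStage13Params (ℓ F θ) k (h18 F θ hP hRg hθ)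

end Guarded

/-! ## §2 The bill minus `hW` (`N = 2`): stub 1's rates conjunct at the pinned reading from THREE kernel letters + the level-0 row, and its LIMIT-currency twin -/

section Bill

variable (𝔯 : RateReading₁₃CoPH 2) (ksel : RunSel) (ℓ : LetterReading) (ℓ₃ : T4Family → NE3Letters₁₁) (g B : T4Family → ℝ) (β : ℝ)
  (s : (F : T4Family) → Stage13HParams F 2 → ℕ) (E₀ : (F : T4Family) → Stage13HParams F 2 → ℝ)
  (hG : GuardedReadingN16 𝔯 ksel ℓ ℓ₃ g B)
  -- THE END's N16 sentence at the loose-data object, one per guarded family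
  (h16 : ∀ (F : T4Family), (∃ θ : Stage13HParams F 2, θ.Provisos₁₃CoPH F 2 ∧ (θ.ZhUnity F 2 ∧ θ.SlotsNondegenerate₁₃ F 2) ∧ θ.Admissible F 2) →
    N16HolderAt (ne3OfRecord₁₁ F { ne3ConstLayerOfRecord₁₁ F 2 (ℓ₃ F) with
      dom := {V | V ∈ ne3DomOfRecord₁₁ F 2 0 0 ∧ V ∈ sfClass 4 F.L (ne3NperOfRecord₁₁ F 0 0) ((ℓ₃ F).ε / B F) 0} }) β)
  -- the U3 letter block's rows
  (hs : ∀ (F : T4Family) (θ : Stage13HParams F 2), θ.Provisos₁₃CoPH F 2 → (θ.ZhUnity F 2 ∧ θ.SlotsNondegenerate₁₃ F 2) → θ.Admissible F 2 → (ℓ F θ).Signs)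
  (hκ : ∀ (F : T4Family) (θ : Stage13HParams F 2), θ.Provisos₁₃CoPH F 2 → (θ.ZhUnity F 2 ∧ θ.SlotsNondegenerate₁₃ F 2) → θ.Admissible F 2 → 0 < (ℓ F θ).κ)
  (hcr : ∀ (F : T4Family) (θ : Stage13HParams F 2), θ.Provisos₁₃CoPH F 2 → (θ.ZhUnity F 2 ∧ θ.SlotsNondegenerate₁₃ F 2) → θ.Admissible F 2 → betaPrime510 4 1 (ℓ F θ).κ ≤ (ℓ F θ).cr)
  (hρ : ∀ (F : T4Family) (θ : Stage13HParams F 2), θ.Provisos₁₃CoPH F 2 → (θ.ZhUnity F 2 ∧ θ.SlotsNondegenerate₁₃ F 2) → θ.Admissible F 2 → 0 ≤ (ℓ F θ).ρ ∧ (ℓ F θ).ρ < 1)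
  -- (1.21) exists; node N22's windowed NE9 letter
  (hL : ∀ (F : T4Family) (θ : Stage13HParams F 2), θ.Provisos₁₃CoPH F 2 → (θ.ZhUnity F 2 ∧ θ.SlotsNondegenerate₁₃ F 2) → θ.Admissible F 2 → PolLimitsExistOfRecord₁₃ F 2 θ.toStage13Params)
  (h9 : ∀ (F : T4Family) (θ : Stage13HParams F 2), θ.Provisos₁₃CoPH F 2 → (θ.ZhUnity F 2 ∧ θ.SlotsNondegenerate₁₃ F 2) → θ.Admissible F 2 →
    WindowedNE9OfRecord₁₃ F 2 θ.toStage13Params (ℓ F θ).κ (ℓ F θ).moduli)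
  -- node N18's windowed step-rate letter ∕ its LIMIT letter
  (hS : ∀ (F : T4Family) (θ : Stage13HParams F 2), θ.Provisos₁₃CoPH F 2 → (θ.ZhUnity F 2 ∧ θ.SlotsNondegenerate₁₃ F 2) → θ.Admissible F 2 →
    WindowedStepRateOfRecord₁₃ F 2 θ.toStage13Params (s F θ) (ℓ F θ).κ (ℓ F θ).θ₅ ((ℓ F θ).C₅ * (ℓ F θ).θ₅))
  (h18 : ∀ (F : T4Family) (θ : Stage13HParams F 2), θ.Provisos₁₃CoPH F 2 → (θ.ZhUnity F 2 ∧ θ.SlotsNondegenerate₁₃ F 2) → θ.Admissible F 2 →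
    KernelStepRateOfRecord₁₃ F 2 θ.toStage13Params (ℓ F θ).κ (ℓ F θ).θ₅ (ℓ F θ).C₅)
  -- THE LEVEL-0 ROWS: windowed (the first RG step's kernel, eventually in the volume) ∕ limiting (the (5.10) class of `Π_1`)
  (h0 : ∀ (F : T4Family) (θ : Stage13HParams F 2), θ.Provisos₁₃CoPH F 2 → (θ.ZhUnity F 2 ∧ θ.SlotsNondegenerate₁₃ F 2) → θ.Admissible F 2 →
    letI := θ.toStage13Params.instVβ₁; letI := θ.toStage13Params.instVβ₂; letI := θ.toStage13Params.instιβ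
    ∀ g ∈ Window θ.toStage13Params.γ, ∀ (μ ν : Fin 4) (z : Fin 4 → ℤ), ∀ᶠ K in atTop,
      |polWindow F K 1 (mergedTermFamilyMatT F 2 (TβOfRecord₁₃ F 2) (chiβOfRecord₁₃ F 2 θ.toStage13Params) θ.toStage13Params.εbg 0 (histPrefix g 0) K)
          θ.toStage13Params.ρ8 θ.toStage13Params.bV μ ν z| ≤ E₀ F θ * Real.exp (-(ℓ F θ).κ * l1 z))
  (h0L : ∀ (F : T4Family) (θ : Stage13HParams F 2), θ.Provisos₁₃CoPH F 2 → (θ.ZhUnity F 2 ∧ θ.SlotsNondegenerate₁₃ F 2) → θ.Admissible F 2 →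
    letI := θ.toStage13Params.instVβ₁; letI := θ.toStage13Params.instVβ₂; letI := θ.toStage13Params.instιβ
    ∀ g ∈ Window θ.toStage13Params.γ, ∀ (μ ν : Fin 4),
      Decay510 (kernelA F (mergedTermFamilyMatT F 2 (TβOfRecord₁₃ F 2) (chiβOfRecord₁₃ F 2 θ.toStage13Params) θ.toStage13Params.εbg)
        θ.toStage13Params.ρ8 θ.toStage13Params.bV g 0 μ ν) (E₀ F θ) (ℓ F θ).κ)
include hG h16 hs hκ hcr hρ hL h9

include hS h0 in
/-- ★★ **STUB 1's RATES CONJUNCT AT THE PINNED READING OF RECORD FROM THREE KERNEL LETTERS + THE LEVEL-0 ROW**: dag-n27-w1's bill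
`keyedRatesHolderD4_rrOfRecord_of_pins_of_letters` with its row `hW` SUPPLIED by §1 from `hS` + signs + `h0`.  Rows read: `h16`, `hs hκ hcr hρ`, `hL h9 hS`, `h0` — the (D4)
windowed-decay letter is NOT an input.  Every row a HYPOTHESIS; NOT a proof of the stub. [bookkeeping] -/
theorem keyedRatesHolderD4_rrOfRecord_of_pins_of_threeLetters_of_base : KeyedRatesHolderD4 β (rrOfRecord 𝔯 ksel) :=
  keyedRatesHolderD4_rrOfRecord_of_pins_of_letters 𝔯 ksel ℓ ℓ₃ g B β s hG h16 hs hκ hcr hρ hL h9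
    (fun F θ hP hGd hθ => windowedDecayOfRecord₁₃_guarded_of_stepRate_of_base (fun F θ => θ.ZhUnity F 2 ∧ θ.SlotsNondegenerate₁₃ F 2) ℓ s E₀ hs hS h0
      F θ hP hGd hθ 0 1) hS

include h18 h0L in
/-- ★ **LIMIT CURRENCY: STUB 1's RATES CONJUNCT AT THE PINNED READING FROM `hL h9` + node N18's LIMIT LETTER + THE LEVEL-0 (5.10) CLASS** — per tuple by dag-n27's (Kꜰ)
`pHolderD4Body_rateCarriers_of_kernels_pin` with `hdec ⟸` §1 (limit currency), `h18 ⟸` dag-n18-w1's face, `h22 ⟸` dag-n27's `n22At_kernels_of_letters_guarded` (`hs hL h9`);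
N14 ∕ N15 behind the pins, N16 from `h16` along the loose pin — exactly the bill's assembly.  Rows read: `h16`, `hs hκ hcr hρ`, `hL h9`, `h18`, `h0L` — NO windowed step-rate
letter, NO windowed (5.10) letter.  Every row a HYPOTHESIS; NOT a proof of the stub. [bookkeeping] -/
theorem keyedRatesHolderD4_rrOfRecord_of_pins_of_limitLetters_of_base : KeyedRatesHolderD4 β (rrOfRecord 𝔯 ksel) := by
  obtain ⟨⟨hpin1, -, hpin2, hpin⟩, hpinL, -, -⟩ := hG
  obtain ⟨b, aS, ν, μ, α, β', c35, p, hb, haS, h2⟩ := hpin2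
  intro F θ hP hGd hθ _ _
  refine ForSmallCouplings.of_forall fun g₀ os => ?_
  refine pHolderD4Body_rateCarriers_of_kernels_pin 𝔯 θ hP g₀ os (ℓ F θ) (hpin F θ hP g₀ os) β (ksel F θ hP g₀ os)
    (YMDAG.N14.TopBorn.n14At_rateCarriersOfRecord₁₃CoPH_of_pinned 𝔯 hpin1 F θ hP g₀ os (ksel F θ hP g₀ os)) ?_ ?_
    (hs F θ hP hGd hθ) (hκ F θ hP hGd hθ) (hcr F θ hP hGd hθ) (hρ F θ hP hGd hθ)
    (kernelDecayOfRecord₁₃_guarded_of_kernelStepRate_of_base (fun F θ => θ.ZhUnity F 2 ∧ θ.SlotsNondegenerate₁₃ F 2) ℓ E₀ hs h18 h0L F θ hP hGd hθ 0 1)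
    (n18At_guarded_of_kernelStepRateOfRecord₁₃ (fun F θ => θ.ZhUnity F 2 ∧ θ.SlotsNondegenerate₁₃ F 2) ℓ h18 F θ hP hGd hθ _)
    (n22At_kernels_of_letters_guarded (fun F θ => θ.ZhUnity F 2 ∧ θ.SlotsNondegenerate₁₃ F 2) ℓ hs hL h9 F θ hP hGd hθ _)
  · rw [h2 F θ hP g₀ os]
    exact Summit.QuantumFields.YangMills.BalabanUVNodes.N15.GenuineRecord.n15At_fullGSizedObjects_family hb haS ν μ α β' c35 p F
  · show N16HolderAt (rateCarriersOfRecord₁₃CoPH 𝔯 F θ hP g₀ os (ksel F θ hP g₀ os)).ne3 β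
    rw [rateCarriers_ne3_of_pinnedLoose hpinL]
    exact h16 F ⟨θ, hP, hGd, hθ⟩

end Bill

/-! ## §3 STUB 1's TEXT VERBATIM from three kernel letters + the level-0 row (and the LIMIT-currency twin); §4 THE ITEM BY NAME with stub 2's text -/

section Stub1

variable (β : ℝ) (hβ : 2 / 3 < β) (hβ' : β < 1) (ℓ : LetterReading) (ℓ₃ : T4Family → NE3Letters₁₁) (g B : T4Family → ℝ)
  (s : (F : T4Family) → Stage13HParams F 2 → ℕ) (E₀ : (F : T4Family) → Stage13HParams F 2 → ℝ)
  (hs : ∀ (F : T4Family) (θ : Stage13HParams F 2), θ.Provisos₁₃CoPH F 2 → (θ.ZhUnity F 2 ∧ θ.SlotsNondegenerate₁₃ F 2) → θ.Admissible F 2 → (ℓ F θ).Signs)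
  (hκ : ∀ (F : T4Family) (θ : Stage13HParams F 2), θ.Provisos₁₃CoPH F 2 → (θ.ZhUnity F 2 ∧ θ.SlotsNondegenerate₁₃ F 2) → θ.Admissible F 2 → 0 < (ℓ F θ).κ)
  (hcr : ∀ (F : T4Family) (θ : Stage13HParams F 2), θ.Provisos₁₃CoPH F 2 → (θ.ZhUnity F 2 ∧ θ.SlotsNondegenerate₁₃ F 2) → θ.Admissible F 2 → betaPrime510 4 1 (ℓ F θ).κ ≤ (ℓ F θ).cr)
  (hρ : ∀ (F : T4Family) (θ : Stage13HParams F 2), θ.Provisos₁₃CoPH F 2 → (θ.ZhUnity F 2 ∧ θ.SlotsNondegenerate₁₃ F 2) → θ.Admissible F 2 → 0 ≤ (ℓ F θ).ρ ∧ (ℓ F θ).ρ < 1)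
  (hL : ∀ (F : T4Family) (θ : Stage13HParams F 2), θ.Provisos₁₃CoPH F 2 → (θ.ZhUnity F 2 ∧ θ.SlotsNondegenerate₁₃ F 2) → θ.Admissible F 2 → PolLimitsExistOfRecord₁₃ F 2 θ.toStage13Params)
  (h9 : ∀ (F : T4Family) (θ : Stage13HParams F 2), θ.Provisos₁₃CoPH F 2 → (θ.ZhUnity F 2 ∧ θ.SlotsNondegenerate₁₃ F 2) → θ.Admissible F 2 →
    WindowedNE9OfRecord₁₃ F 2 θ.toStage13Params (ℓ F θ).κ (ℓ F θ).moduli)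
  (hE : N16LettersEnd 2 g ℓ₃) (hM : N16RadiusMatch ℓ₃ B)
  (hS : ∀ (F : T4Family) (θ : Stage13HParams F 2), θ.Provisos₁₃CoPH F 2 → (θ.ZhUnity F 2 ∧ θ.SlotsNondegenerate₁₃ F 2) → θ.Admissible F 2 →
    WindowedStepRateOfRecord₁₃ F 2 θ.toStage13Params (s F θ) (ℓ F θ).κ (ℓ F θ).θ₅ ((ℓ F θ).C₅ * (ℓ F θ).θ₅))
  (h18 : ∀ (F : T4Family) (θ : Stage13HParams F 2), θ.Provisos₁₃CoPH F 2 → (θ.ZhUnity F 2 ∧ θ.SlotsNondegenerate₁₃ F 2) → θ.Admissible F 2 →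
    KernelStepRateOfRecord₁₃ F 2 θ.toStage13Params (ℓ F θ).κ (ℓ F θ).θ₅ (ℓ F θ).C₅)
  (h0 : ∀ (F : T4Family) (θ : Stage13HParams F 2), θ.Provisos₁₃CoPH F 2 → (θ.ZhUnity F 2 ∧ θ.SlotsNondegenerate₁₃ F 2) → θ.Admissible F 2 →
    letI := θ.toStage13Params.instVβ₁; letI := θ.toStage13Params.instVβ₂; letI := θ.toStage13Params.instιβ
    ∀ g ∈ Window θ.toStage13Params.γ, ∀ (μ ν : Fin 4) (z : Fin 4 → ℤ), ∀ᶠ K in atTop,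
      |polWindow F K 1 (mergedTermFamilyMatT F 2 (TβOfRecord₁₃ F 2) (chiβOfRecord₁₃ F 2 θ.toStage13Params) θ.toStage13Params.εbg 0 (histPrefix g 0) K)
          θ.toStage13Params.ρ8 θ.toStage13Params.bV μ ν z| ≤ E₀ F θ * Real.exp (-(ℓ F θ).κ * l1 z))
  (h0L : ∀ (F : T4Family) (θ : Stage13HParams F 2), θ.Provisos₁₃CoPH F 2 → (θ.ZhUnity F 2 ∧ θ.SlotsNondegenerate₁₃ F 2) → θ.Admissible F 2 →
    letI := θ.toStage13Params.instVβ₁; letI := θ.toStage13Params.instVβ₂; letI := θ.toStage13Params.instιβ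
    ∀ g ∈ Window θ.toStage13Params.γ, ∀ (μ ν : Fin 4),
      Decay510 (kernelA F (mergedTermFamilyMatT F 2 (TβOfRecord₁₃ F 2) (chiβOfRecord₁₃ F 2 θ.toStage13Params) θ.toStage13Params.εbg)
        θ.toStage13Params.ρ8 θ.toStage13Params.bV g 0 μ ν) (E₀ F θ) (ℓ F θ).κ)
  (h16 : ∀ (F : T4Family), (∃ θ : Stage13HParams F 2, θ.Provisos₁₃CoPH F 2 ∧ (θ.ZhUnity F 2 ∧ θ.SlotsNondegenerate₁₃ F 2) ∧ θ.Admissible F 2) →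
    N16HolderAt (ne3OfRecord₁₁ F { ne3ConstLayerOfRecord₁₁ F 2 (ℓ₃ F) with
      dom := {V | V ∈ ne3DomOfRecord₁₁ F 2 0 0 ∧ V ∈ sfClass 4 F.L (ne3NperOfRecord₁₁ F 0 0) ((ℓ₃ F).ε / B F) 0} }) β)
  (h₂ : ∀ β : ℝ, 2 / 3 < β → β < 1 → ∀ (𝔯 : RateReading₁₃CoPH 2) (ksel : RunSel) (ℓ : LetterReading) (ℓ₃ : T4Family → Node00.NE3Letters₁₁) (g B : T4Family → ℝ),
    GuardedReadingN16 𝔯 ksel ℓ ℓ₃ g B → KeyedRatesHolderD4 β (rrOfRecord 𝔯 ksel) →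
    ∃ (jc : CutReading) (sh : ShellSplit₁₃CoPH 2 0) (cr : SpineReading), PinnedAtLive jc sh cr ∧
      KeyedRelWeight cr ∧ KeyedShellWeight cr ∧ KeyedExtraction cr ∧ KeyedCoreEdgeHolderD4 β cr (rrOfRecord 𝔯 ksel))
include hβ hβ' hs hκ hcr hρ hL h9

include hE hM hS h0 h16 in
/-- ★★ **STUB 1's TEXT FROM THREE KERNEL LETTERS + THE LEVEL-0 ROW.**  K3⁷ v5's `stub_rates13H` text VERBATIM (over the mirrored names) from: `β ∈ ]2/3, 1[`; node N16's two
letter rows `hE hM`; ONE `N16HolderAt … β` per guarded family at the loose-data object (`h16`); the U3 letter rows; the kernel letters `hL h9 hS`; the level-0 row `h0` —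
dag-n27-w1's `stub1Text_of_rows` with `hW` SUPPLIED by §1 (the N16-PRODUCER form follows exactly as in dag-n27-w1's `stub1Text_of_n16Producer_of_rows`, same `hW`).  Every estimate
row a displayed HYPOTHESIS; NOT a proof of the stub. [bookkeeping] -/
theorem stub1Text_of_threeLetters_of_base :
    ∃ β : ℝ, 2 / 3 < β ∧ β < 1 ∧
      ∃ (𝔯 : RateReading₁₃CoPH 2) (ksel : RunSel) (ℓ : LetterReading) (ℓ₃ : T4Family → Node00.NE3Letters₁₁) (g B : T4Family → ℝ),
        GuardedReadingN16 𝔯 ksel ℓ ℓ₃ g B ∧ KeyedRatesHolderD4 β (rrOfRecord 𝔯 ksel) :=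
  stub1Text_of_rows β hβ hβ' ℓ ℓ₃ g B s hE hM hs hκ hcr hρ hL h9
    (fun F θ hP hGd hθ => windowedDecayOfRecord₁₃_guarded_of_stepRate_of_base (fun F θ => θ.ZhUnity F 2 ∧ θ.SlotsNondegenerate₁₃ F 2) ℓ s E₀ hs hS h0
      F θ hP hGd hθ 0 1) hS h16

include hE hM h18 h0L h16 in
/-- **LIMIT CURRENCY: STUB 1's TEXT FROM `hL h9` + node N18's LIMIT LETTER + THE LEVEL-0 (5.10) CLASS** (the minted all-pins reading of p608315 + §2's limit bill; selector `0`).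
NO windowed step-rate letter, NO windowed (5.10) letter.  NOT a proof of the stub. [bookkeeping] -/
theorem stub1Text_of_limitLetters_of_base :
    ∃ β : ℝ, 2 / 3 < β ∧ β < 1 ∧
      ∃ (𝔯 : RateReading₁₃CoPH 2) (ksel : RunSel) (ℓ : LetterReading) (ℓ₃ : T4Family → Node00.NE3Letters₁₁) (g B : T4Family → ℝ),
        GuardedReadingN16 𝔯 ksel ℓ ℓ₃ g B ∧ KeyedRatesHolderD4 β (rrOfRecord 𝔯 ksel) := by
  obtain ⟨𝔯, h1, h2, h3, hpL⟩ := exists_reading_v5pins 1 0 1 1 0 0 0 0 0 0 ℓ ℓ₃ B one_pos le_rfl one_pos one_pos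
  have hG : GuardedReadingN16 𝔯 (fun _ _ _ _ _ => 0) ℓ ℓ₃ g B := (guardedReadingN16_iff_pins_letterRows _ ℓ ℓ₃ g B).2 ⟨⟨h1, h2, h3, hpL⟩, hE, hM⟩
  exact ⟨β, hβ, hβ', 𝔯, fun _ _ _ _ _ => 0, ℓ, ℓ₃, g, B, hG,
    keyedRatesHolderD4_rrOfRecord_of_pins_of_limitLetters_of_base 𝔯 (fun _ _ _ _ _ => 0) ℓ ℓ₃ g B β E₀ hG h16 hs hκ hcr hρ hL h9 h18 h0L⟩

include hE hM hS h0 h16 h₂ in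
/-- ★★ **K3⁷ BY NAME FROM THREE KERNEL LETTERS + THE LEVEL-0 ROW AND STUB 2's TEXT** (dag-n27-w1's `spineGivenEndpointR13SepCoPH_of_stubTexts` ∘ §3): under v5's pins the item
⊢ `Summit.QuantumFields.YangMills.Theses.BalabanUVNodes.SpineGivenEndpointR13SepCoPH` costs `h16` + the U3 rows + node N16's two rows + `hL h9 hS` + the level-0 row + K3⁷ v5's
`stub_expansion13H` text `h₂` — the (D4) windowed-decay letter is NOT an input (stub 2's LETTER FORM is one `stub2Text_iff_letterForm.2` away).  Every row a displayed HYPOTHESIS;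
NOT a proof of either stub; K3⁷ OPEN. [bookkeeping] -/
theorem spineGivenEndpointR13SepCoPH_of_threeLetters_of_base_of_stub2Text :
    Summit.QuantumFields.YangMills.Theses.BalabanUVNodes.SpineGivenEndpointR13SepCoPH :=
  spineGivenEndpointR13SepCoPH_of_stubTexts (stub1Text_of_threeLetters_of_base β hβ hβ' ℓ ℓ₃ g B s E₀ hs hκ hcr hρ hL h9 hE hM hS h0 h16) h₂

include hE hM h18 h0L h16 h₂ in
/-- **LIMIT CURRENCY: K3⁷ BY NAME FROM `hL h9` + node N18's LIMIT LETTER + THE LEVEL-0 (5.10) CLASS AND STUB 2's TEXT.**  NO windowed step-rate ∕ windowed (5.10) letter.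
Every row a displayed HYPOTHESIS; NOT a proof of either stub; K3⁷ OPEN. [bookkeeping] -/
theorem spineGivenEndpointR13SepCoPH_of_limitLetters_of_base_of_stub2Text :
    Summit.QuantumFields.YangMills.Theses.BalabanUVNodes.SpineGivenEndpointR13SepCoPH :=
  spineGivenEndpointR13SepCoPH_of_stubTexts (stub1Text_of_limitLetters_of_base β hβ hβ' ℓ ℓ₃ g B E₀ hs hκ hcr hρ hL h9 hE hM h18 h0L h16) h₂

end Stub1

/-! ## §5 (E) Node N17's scale-shift sentence at the LIMIT level: N18's limit letter + the level-0 (5.10) class, NO (1.21)-existence and NO (UD) letter -/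

section Limit

variable {𝔄 : Type*} [NormedRing 𝔄] [NormedAlgebra ℝ 𝔄]
variable {V : Type*} [NormedAddCommGroup V] [NormedSpace ℝ V] {ι : Type*} [Fintype ι]
variable (F : T4Family) (ℰ : TermFamily1 F 𝔄) (ρ : V →L[ℝ] 𝔄) (bV : Module.Basis ι ℝ V) {N : ℕ} [NeZero N]

variable {ℰ} in
/-- ★ **(E) NODE N17's (J2) SENTENCE AT THE LIMIT LEVEL** for ANY term family `ℰ`: W1-19b's `KernelStepRate F ℰ ρ bV θ.γ ℓ.κ ℓ.θ₅ ℓ.C₅` (node N18's limit letter), the signs,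
`0 < ℓ.κ` and the level-0 (5.10) class `Decay510 (Π_1(g_0; ·)) E₀ ℓ.κ` on the window give `ScaleShiftRate (betaPrime510 4 (ℓ.C₅·ℓ.θ₅) ℓ.κ) ℓ.θ₅ θ.γ (betaMerged F ℰ ρ bV)` —
dag-n18-w1's `scaleShiftRate_betaMerged_of_n18At_objects_of_decayBound` with its (UD) input `hU` PRODUCED by FILE 5 §2 (`δ := ℓ.κ`); NO `PolLimitsExist` letter is read.
[cite: Balaban1987RG1, Thm 1 p.259, (1.20)–(1.22) p.264 and (5.10) p.293 (mechanism; nothing of the source asserted)] -/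
theorem scaleShiftRate_betaMerged_of_kernelStepRate_of_base (θ : Stage13Params F N) (ℓ : U3Letters₁₁) (hs : ℓ.Signs) (hκ : 0 < ℓ.κ) {E₀ : ℝ}
    (h18 : KernelStepRate F ℰ ρ bV θ.γ ℓ.κ ℓ.θ₅ ℓ.C₅)
    (h0 : ∀ g ∈ Window θ.γ, ∀ (μ ν : Fin 4), Decay510 (kernelA F ℰ ρ bV g 0 μ ν) E₀ ℓ.κ) :
    ScaleShiftRate (betaPrime510 4 (ℓ.C₅ * ℓ.θ₅) ℓ.κ) ℓ.θ₅ θ.γ (betaMerged F ℰ ρ bV) :=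
  scaleShiftRate_betaMerged_of_n18At_objects_of_decayBound F ℰ ρ bV θ ℓ 0
    ((n18At_u3OfRecord₁₃_objects_iff_kernelStepRate_letter F ℰ ρ bV θ ℓ 0).2 h18) hκ hκ
    (decayBound_EA_of_kernelStepRate_of_base F ρ bV hs.θ₅_pos.le hs.θ₅_lt_one hs.C₅_nonneg h18 h0)

/-- **(E) AT THE RECORD**: node N18's limit letter of record `KernelStepRateOfRecord₁₃ F N θ ℓ.κ ℓ.θ₅ ℓ.C₅`, the signs, `0 < ℓ.κ` and the level-0 (5.10) class of the LIMITING
kernels of the merged term of record give node N17's scale-shift sentence of the merged β of record — with NO (1.21)-existence letter and NO (UD) letter (compare FILE 5 §5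
`scaleShiftRate_betaMergedOfRecord_of_windowedStepRateOfRecord₁₃_of_base`, which reads `hL` + `hS`). [cite: Balaban1987RG1, Thm 1 p.259, (1.6) p.261 and (1.20)–(1.22) p.264 (mechanism; nothing of the record asserted)] -/
theorem scaleShiftRate_betaMergedOfRecord_of_kernelStepRateOfRecord₁₃_of_base (θ : Stage13Params F N) (ℓ : U3Letters₁₁) (hs : ℓ.Signs) (hκ : 0 < ℓ.κ) {E₀ : ℝ}
    (h18 : KernelStepRateOfRecord₁₃ F N θ ℓ.κ ℓ.θ₅ ℓ.C₅)
    (h0 : letI := θ.instVβ₁; letI := θ.instVβ₂; letI := θ.instιβ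
      ∀ g ∈ Window θ.γ, ∀ (μ ν : Fin 4),
        Decay510 (kernelA F (mergedTermFamilyMatT F N (TβOfRecord₁₃ F N) (chiβOfRecord₁₃ F N θ) θ.εbg) θ.ρ8 θ.bV g 0 μ ν) E₀ ℓ.κ) :
    letI := θ.instVβ₁; letI := θ.instVβ₂; letI := θ.instιβ
    ScaleShiftRate (betaPrime510 4 (ℓ.C₅ * ℓ.θ₅) ℓ.κ) ℓ.θ₅ θ.γ
      (betaMerged F (mergedTermFamilyMatT F N (TβOfRecord₁₃ F N) (chiβOfRecord₁₃ F N θ) θ.εbg) θ.ρ8 θ.bV) := by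
  letI := θ.instVβ₁; letI := θ.instVβ₂; letI := θ.instιβ
  exact scaleShiftRate_betaMerged_of_kernelStepRate_of_base F θ.ρ8 θ.bV θ ℓ hs hκ h18 h0

end Limit

/-! ## §6 A6 (model level): the level-0 row JOINTLY with the step-rate letter at dag-n18-w2's fading on-site family, and FILE 5's telescope on them -/

/-- **THE LEVEL-0 ROW AT THE FADING MODEL** (`0 ≤ ω`, every window `]0, γ]`, every rate `κ`): eventually in the volume the first-step windowed kernel is the on-site number
`ω·g_0·[μ = ν = 0]·[z = 0]`, so the row holds with `E₀ := |γ|·ω`.  MODEL LEVEL; nothing of the record. [cite: Balaban1987RG1, (1.20)–(1.21) p.264 and (5.10) p.293; model] -/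
theorem baseRow_fading (F : T4Family) {ω : ℝ} (hω : 0 ≤ ω) (γ κ : ℝ) :
    ∀ g ∈ Window γ, ∀ (μ ν : Fin 4) (z : Fin 4 → ℤ), ∀ᶠ K in atTop,
      |polWindow F K 1 (fadingTermFamily F ω 0 (histPrefix g 0) K) (ContinuousLinearMap.id ℝ ℝ) (Module.Basis.singleton Unit ℝ) μ ν z| ≤
        (|γ| * ω) * Real.exp (-κ * l1 z) := by
  intro g hg μ ν z
  filter_upwards [polWindow_fadingTermFamily_eventually F ω 0 (histPrefix g 0) μ ν z] with K hK
  rw [hK]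
  have hC : 0 ≤ |γ| * ω * Real.exp (-κ * l1 z) := mul_nonneg (mul_nonneg (abs_nonneg γ) hω) (Real.exp_nonneg _)
  split_ifs with h
  · obtain ⟨-, -, rfl⟩ := h
    have h0 : l1 (0 : Fin 4 → ℤ) = 0 := by simp [l1]
    have hg0 := mem_window.1 hg 0
    rw [h0, mul_zero, Real.exp_zero, mul_one, fadingAmp_zero, histPrefix_apply, abs_mul, abs_of_nonneg hω, mul_comm |γ| ω]
    exact mul_le_mul_of_nonneg_left ((abs_of_pos hg0.1).le.trans (hg0.2.trans (le_abs_self γ))) hω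
  · rw [abs_zero]
    exact hC

/-- **FILE 5's TELESCOPE IS NON-VACUOUS AT THE MODEL**: the step-rate letter (`windowedStepRate_fading`, `θ₅ := ω`, `C′ := |γ|ω·ω`, any run offset `s`) and the level-0 row
(`baseRow_fading`) hold JOINTLY for `0 ≤ ω < 1`, and `windowedDecayUniform_of_windowedStepRate_of_base` returns W1-19c's uniform letter with constant `|γ|ω + |γ|ω·ω∕(1−ω)`.
MODEL LEVEL (A6 for the conjunction of FILE 5 ∕ §1's hypotheses); nothing of the record. [cite: Balaban1987RG1, Thm 1 p.259 and (5.10) p.293; model] -/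
theorem windowedDecayUniform_fading_of_stepRate_of_base (F : T4Family) {ω : ℝ} (hω : 0 ≤ ω) (hω1 : ω < 1) (γ κ : ℝ) (s : ℕ) :
    WindowedDecayUniform F (fadingTermFamily F ω) (ContinuousLinearMap.id ℝ ℝ) (Module.Basis.singleton Unit ℝ) (Window γ)
      (|γ| * ω + (|γ| * ω) * ω / (1 - ω)) κ :=
  windowedDecayUniform_of_windowedStepRate_of_base F (ContinuousLinearMap.id ℝ ℝ) (Module.Basis.singleton Unit ℝ) hω hω1
    (mul_nonneg (mul_nonneg (abs_nonneg γ) hω) hω) (windowedStepRate_fading F hω γ s κ) (baseRow_fading F hω γ κ)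

end YMDAG.N18.ThreeKernelLettersAndBase

end
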